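import Mathlib.LinearAlgebra.Matrix.Rank
import Literature.Computability.AlgebraicComplexity.MatrixMultiplicationExponent
import HarnessLib

/-!
# ω-census family (a): decompositions of `⟨k,m,n⟩` whose X-forms all have rank `≤ 1` need `k·m·n` terms

Cell `pub-omega` (HOME `run/shared/lean/pub/pub-omega/`, unit `pub-omega-tensor-g4`), topic
`Summits/MatrixMultiplication/OmegaCensus`. Framing (verbatim): lottery ticket; floor = certified
bounds/negative ranges.

THE LEMMA (ours, elementary; the '4-way flattening lemma' of TABLE-family-a-search-gen4.md §G4-3e).
Let `⟨k,m,n⟩ = ∑_{s ∈ σ} w_s ⊗ u_s ⊗ v_s` be any triad decomposition of the matrix multiplication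
tensor (Bläser's indexing: first slot the output form `Z_{κν}`, second the variable `X_{κμ}`, third the
variable `Y_{μν}`) in which every X-component `u_s`, read as a `k × m` matrix, has rank `≤ 1`, i.e.
`u_s (κ, μ) = r_s κ · c_s μ`. Then `|σ| ≥ k·m·n` — the standard algorithm is optimal among such
decompositions, over every field.

Proof: regroup the 4-tensor `∑_{κμν} e_{κν} ⊗ e_κ ⊗ e_μ ⊗ e_{μν}` as a matrix `M` with rows
`(κ', (μ', ν'))` (X-row index, Y-variable) and columns `(μ, (κ, ν))` (X-column index, output): `M` is a
permutation matrix of size `k·m·n`, hence of rank `k·m·n`, while each term contributes the rank-`≤ 1`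
matrix `(r_s ⊗ v_s)(c_s ⊗ w_s)ᵀ`; rank is subadditive.

USE in the census: it empties the 'all X-forms rank 1' family of the normal-form case splits behind
the SAT certificates for `R_𝔽₂(⟨2,2,5⟩) = 18` and `R_𝔽₃(⟨2,2,5⟩) ≥ 17` (every rung with `r < 4n`), and
with the X-marginal enumeration over `𝔽₂` it re-derives `R_𝔽₂(⟨2,2,5⟩) ≥ 18` (Hopcroft–Kerr 1971)
without any SAT solving. No new bound on any rank is claimed here.
-/

namespace Summit.MatrixMultiplication.OmegaCensus

open Matrix

namespace RankOneXForms

variable {K : Type} [Field K]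

/-- Subadditivity of `Matrix.rank` over a finite sum (folklore; re-proved here to keep the imports
light). [folklore] -/
private theorem rank_sum_le {ρ γ ι : Type} [Fintype ρ] [Fintype γ] (s : Finset ι)
    (A : ι → Matrix ρ γ K) : (∑ i ∈ s, A i).rank ≤ ∑ i ∈ s, (A i).rank := by
  classical
  have hadd : ∀ A B : Matrix ρ γ K, (A + B).rank ≤ A.rank + B.rank := by
    intro A B
    unfold Matrix.rank
    rw [Matrix.mulVecLin_add]
    calc Module.finrank K (LinearMap.range (A.mulVecLin + B.mulVecLin))
        ≤ Module.finrank K ↥(LinearMap.range A.mulVecLin ⊔ LinearMap.range B.mulVecLin) := by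
          apply Submodule.finrank_mono
          rintro _ ⟨x, rfl⟩
          exact Submodule.add_mem_sup ⟨x, rfl⟩ ⟨x, rfl⟩
      _ ≤ _ := Submodule.finrank_add_le_finrank_add_finrank _ _
  induction s using Finset.induction_on with
  | empty => simp
  | insert a s ha ih =>
      rw [Finset.sum_insert ha, Finset.sum_insert ha]
      exact (hadd _ _).trans (Nat.add_le_add_left ih _)

/-- The `(X-row, Y-variable) × (X-column, output)` regrouping of the matrix multiplication tensor is
a permutation matrix, hence has full rank `k·m·n`. [folklore] -/
theorem rank_regroup_matMulTensor (k m n : ℕ) :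
    (Matrix.of fun (p : Fin k × (Fin m × Fin n)) (q : Fin m × (Fin k × Fin n)) =>
        Literature.Computability.AlgebraicComplexity.matMulTensor K k m n q.2 (p.1, q.1) p.2).rank
      = k * (m * n) := by
  -- the relabelling `(μ, (κ, ν)) ↦ (κ, (μ, ν))`
  let e : Fin m × (Fin k × Fin n) ≃ Fin k × (Fin m × Fin n) :=
    ⟨fun q => (q.2.1, (q.1, q.2.2)), fun p => (p.2.1, (p.1, p.2.2)), fun _ => rfl, fun _ => rfl⟩
  have hM : (Matrix.of fun (p : Fin k × (Fin m × Fin n)) (q : Fin m × (Fin k × Fin n)) =>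
        Literature.Computability.AlgebraicComplexity.matMulTensor K k m n q.2 (p.1, q.1) p.2)
      = Matrix.reindex (Equiv.refl _) e.symm (1 : Matrix _ _ K) := by
    ext p q
    obtain ⟨κ', μ', ν'⟩ := p
    obtain ⟨μ, κ, ν⟩ := q
    simp only [Matrix.of_apply, Literature.Computability.AlgebraicComplexity.matMulTensor,
      Matrix.reindex_apply, Equiv.refl_symm, Equiv.coe_refl, Matrix.submatrix_apply, id_eq,
      Equiv.symm_symm, Matrix.one_apply, e, Equiv.coe_fn_mk, Prod.mk.injEq, @eq_comm _ κ' κ,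
      @eq_comm _ μ' μ, @eq_comm _ ν' ν]
  rw [hM, Matrix.rank_reindex, Matrix.rank_one]
  simp [Fintype.card_prod]

/-- THE LEMMA. Any triad decomposition of `⟨k,m,n⟩` indexed by a finite type `σ` in which every
X-component is a rank-`≤ 1` matrix (`u_s (κ, μ) = r_s κ · c_s μ`) has `|σ| ≥ k·m·n`; equivalently the
standard algorithm is optimal among decompositions with rank-one X-forms, over every field.
[folklore] -/
theorem kmn_le_card_of_rankOne_X (k m n : ℕ) {σ : Type} [Fintype σ]
    (w : σ → Fin k × Fin n → K) (u : σ → Fin k × Fin m → K) (v : σ → Fin m × Fin n → K)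
    (hdec : Literature.Computability.AlgebraicComplexity.matMulTensor K k m n
      = ∑ s, Literature.Computability.AlgebraicComplexity.triad (w s) (u s) (v s))
    (hrk : ∀ s, ∃ (r : Fin k → K) (c : Fin m → K), ∀ κ μ, u s (κ, μ) = r κ * c μ) :
    k * m * n ≤ Fintype.card σ := by
  classical
  choose r c hrc using hrk
  -- regroup both sides of the decomposition
  have hM : (Matrix.of fun (p : Fin k × (Fin m × Fin n)) (q : Fin m × (Fin k × Fin n)) =>
        Literature.Computability.AlgebraicComplexity.matMulTensor K k m n q.2 (p.1, q.1) p.2)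
      = ∑ s, Matrix.vecMulVec (fun p : Fin k × (Fin m × Fin n) => r s p.1 * v s p.2)
          (fun q : Fin m × (Fin k × Fin n) => c s q.1 * w s q.2) := by
    ext p q
    rw [Matrix.of_apply, hdec, Finset.sum_apply, Finset.sum_apply, Finset.sum_apply, Matrix.sum_apply]
    refine Finset.sum_congr rfl fun s _ => ?_
    simp only [Literature.Computability.AlgebraicComplexity.triad_apply, Matrix.vecMulVec_apply, hrc]
    ring
  have hrank := rank_regroup_matMulTensor (K := K) k m n
  rw [hM] at hrank
  have hle : (∑ s, Matrix.vecMulVec (fun p : Fin k × (Fin m × Fin n) => r s p.1 * v s p.2)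
      (fun q : Fin m × (Fin k × Fin n) => c s q.1 * w s q.2)).rank ≤ Fintype.card σ := by
    refine (rank_sum_le _ _).trans ?_
    calc ∑ s, (Matrix.vecMulVec (fun p : Fin k × (Fin m × Fin n) => r s p.1 * v s p.2)
          (fun q : Fin m × (Fin k × Fin n) => c s q.1 * w s q.2)).rank
        ≤ ∑ _s : σ, 1 := Finset.sum_le_sum fun s _ => Matrix.rank_vecMulVec_le _ _
      _ = Fintype.card σ := by simp
  rw [hrank] at hle
  simpa [mul_assoc] using hle

/-- Specialisation used by the census: for `⟨2,2,n⟩`, rank-one X-forms force at least `4n` terms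
(this empties the 'all X-forms rank 1' family of the SAT case splits at the rungs `⟨2,2,3⟩@10`,
`⟨2,2,4⟩@13`, `⟨2,2,5⟩@16/17`). [folklore] -/
theorem four_mul_le_card_of_rankOne_X_22n (n : ℕ) {σ : Type} [Fintype σ]
    (w : σ → Fin 2 × Fin n → K) (u : σ → Fin 2 × Fin 2 → K) (v : σ → Fin 2 × Fin n → K)
    (hdec : Literature.Computability.AlgebraicComplexity.matMulTensor K 2 2 n
      = ∑ s, Literature.Computability.AlgebraicComplexity.triad (w s) (u s) (v s))
    (hrk : ∀ s, ∃ (r : Fin 2 → K) (c : Fin 2 → K), ∀ κ μ, u s (κ, μ) = r κ * c μ) :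
    4 * n ≤ Fintype.card σ := by
  have h := kmn_le_card_of_rankOne_X 2 2 n w u v hdec hrk
  omega

end RankOneXForms

end Summit.MatrixMultiplication.OmegaCensus
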